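import Summits.CriticalPhenomena.PercolationContinuityZ3.Theorems.PercNearOneGluingNoHeavyLowerTailSunflowerMultiPetalKempeVertexMonotone
import HarnessLib
import HarnessLib.Audit

/-!
# `NoHeavyLowerTail` (crux stmt-CriticalPhenomena-4575), two-terminal inequality (C*): the finite cores of the
# NEIGHBOURHOOD-CONTRACTION STEP LAW  `T(K;u,v) ≥ T(K−y;u,v) + T((K−y)/(N(y)∖{v} → u);u,v)`

Support file (seat `prim-l12-p2` gen 47; `--supports stmt-CriticalPhenomena-4575`; continuation of `…KempeVertexMonotone` (p421779: `kerTAbs`,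
`Tfun_sub_Tfun_induce_eq_sum_kerTAbs`) and `…KempeVertexKernelSparsity` (p551015: the defect table `kerTAbs_neg_cells_of_fst_ne_zero`)).
Finite checks only (`decide` over capped types); no `sorry`; nothing is asserted about the crux.
Memo: run/shared/lean/prim/prim-l12/prim-l12-p2/FINDING-g47-NEIGHBOURHOOD-CONTRACTION-STEP.md §3.

THE STEP LAW (memo §2, THEOREM L1; proved there for every marked multigraph `K`, terminals `u ≠ v`, and every UNMARKED non-terminal `y`
adjacent to `u`, for every degree of `y`):  `T(K;u,v) ≥ T(K−y;u,v) + T((K−y)/(S ∪ {u});u,v)`, where `S = N(y) ∖ {u,v}` and the last graph is `K − y`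
with `S` merged into the terminal `u`.  Both graphs on the right have fewer vertices, so the law closes the induction for (C*) (`T ≥ 0` for all marked
multigraphs; memo §4), hence Lemma B for all marked multigraphs (gen-41 THEOREM R) and ★ₖ for graph clutters (gen 36).

THE CELL RESIDUAL.  Grouping the colourings of `K − y` by the colouring `τ₀` of `K − y − S` and the colouring `x` of `S`, the difference
`T(K) − T(K−y) − T((K−y)/(S∪u))` is `6 · Σ_cells R₁` with  `R₁ = kerTAbs t k − [x ≡ colour 0] · fC t`  (`t` = capped type of `K − y` at the cell,
`k` = capped colour increments of `y`, `k.1 ≠ 0` because `y ∼ u`; the all-`0` cells are exactly the colourings of the contracted graph).  The proof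
(memo §3) is a charging argument inside the pair of rows `(τ₀, Φ_u τ₀)`, `Φ_u` = Lemma B1's swap of the colours `0 ↔ 2` off `u`; it rests on the
following finite facts, which are what this file kernel-checks:
* `kerTAbs_sub_fC_nonneg_of_all_zero` — at the all-`0` cells (`k = (2, k₁, 0)`) the residual `kerTAbs t k − fC t` is `≥ 0` for EVERY type: the
  contraction kernel cancels the all-`0` defects of the one-point kernel exactly (`kerTAbs (0,0,1) (2,0,0) = −2 = fC (0,0,1)`, …);
* `kerTAbs_deficit_value` — the four remaining defect families of the table `kerTAbs_neg_cells_of_fst_ne_zero` that occur for `|S| ≥ 2`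
  (profiles `(1,0,2)`, `(1,2,0)`, `(2,0,1)`, `(2,1,0)`) all have value exactly `−1`;
* `payer_allZero`, `payer_allOne`, `payer_sibling`, `payer_allTwoButOne` — the four PAYER cells of the charging have residual exactly `2`
  (types `(≥1,0,0)` with profile `(2,0,0)` minus `fC`; `(≥1,0,0)` with `(1,2,0)`; `(0,≥1,0)` with `(2,1,0)`; `(≥1,0,0)` with `(2,0,2)`);
* `pendant_pair_nonneg` — the degree-`0` case (`S = ∅`, law `T(K) ≥ 2·T(K−y)`) in paired form: for every pair of base types
  `(I₀ ⊕ P, B, I₂)` and `(I₂ ⊕ P', B, I₀)` exchanged by `Φ_u`, the two residuals sum to `≥ 0`.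
The marked-vertex case of the induction (memo §4(a): a marked `y` is deleted monotonically, pointwise) is `kerTAbs_nonneg_of_ne_zero` (p421779).
-/

namespace Summit.CriticalPhenomena.PercolationContinuityZ3.Theorems.SunflowerPartition.Kempe

/-- **Exact cancellation at the all-`0` cells.**  When all of `S` is coloured `0` (profile `k = (2, k₁, 0)`: `y ∼ u` and at least one further
`0`-neighbour, no `2`-neighbour), the residual of the neighbourhood-contraction law, `kerTAbs t k − fC t`, is nonnegative at every type `t`.
(finite check) [this work] -/
theorem kerTAbs_sub_fC_nonneg_of_all_zero : ∀ t : CType, ∀ k₁ : Fin 3, 0 ≤ kerTAbs t (2, k₁, 0) - fC t := by decide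

/-- The values at the all-`0` cells with `k = (2,0,0)`: the residual is `2·[t.2.1 = 0 ∧ t.2.2 = 0]`. (finite check) [this work] -/
theorem kerTAbs_sub_fC_two_zero_zero : ∀ t : CType,
    kerTAbs t (2, 0, 0) - fC t = if t.2.1 = 0 ∧ t.2.2 = 0 then 2 else 0 := by decide

/-- **The four deficit families have value `−1`.**  For the profiles `(1,0,2)` (all of `S` coloured `2`), `(1,2,0)` (all coloured `1`),
`(2,0,1)` (all `0` but one `2`), `(2,1,0)` (all `0` but one `1`) the one-point kernel is `≥ −1` at every type, with `−1` exactly at the types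
`(0,0,1)`, `(0,0,1)`, `(0,1,0)`, `(0,0,1)` respectively. (finite check) [this work] -/
theorem kerTAbs_deficit_value : ∀ t : CType,
    (-1 ≤ kerTAbs t (1, 0, 2) ∧ (kerTAbs t (1, 0, 2) < 0 ↔ t = (0, 0, 1))) ∧
    (-1 ≤ kerTAbs t (1, 2, 0) ∧ (kerTAbs t (1, 2, 0) < 0 ↔ t = (0, 0, 1))) ∧
    (-1 ≤ kerTAbs t (2, 0, 1) ∧ (kerTAbs t (2, 0, 1) < 0 ↔ t = (0, 1, 0))) ∧
    (-1 ≤ kerTAbs t (2, 1, 0) ∧ (kerTAbs t (2, 1, 0) < 0 ↔ t = (0, 0, 1))) := by decide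

set_option synthInstance.maxHeartbeats 400000 in
set_option synthInstance.maxSize 4096 in
/-- **No other deficits for `|S| ≥ 2`.**  With `k.1 ≠ 0` and `k` none of the small-degree profiles `(1,0,0)`, `(1,0,1)`, `(1,1,0)`
(which need `|S| ≤ 1`), a negative one-point kernel forces `k ∈ {(1,0,2), (1,2,0), (2,0,1), (2,1,0), (2,0,0)}`; the profile `(2,0,0)` (all of `S`
coloured `0`) is cancelled by `kerTAbs_sub_fC_nonneg_of_all_zero`. (finite check; a re-reading of `kerTAbs_neg_cells_of_fst_ne_zero`) [this work] -/
theorem kerTAbs_neg_profiles_of_two_le : ∀ t k : CType, k.1 ≠ 0 → k ≠ (1, 0, 0) → k ≠ (1, 0, 1) → k ≠ (1, 1, 0) →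
    kerTAbs t k < 0 → k = (1, 0, 2) ∨ k = (1, 2, 0) ∨ k = (2, 0, 1) ∨ k = (2, 1, 0) ∨ k = (2, 0, 0) := by decide

/-- **Payer of the all-`2` deficit** (memo §3, P1: the `Φ_u`-partner cell, all of `S` coloured `0`, type `(≥1, 0, 0)`, profile `(2,0,0)`):
residual `kerTAbs t (2,0,0) − fC t = 2`. (finite check) [this work] -/
theorem payer_allZero : ∀ a : Fin 3, a ≠ 0 → kerTAbs (a, 0, 0) (2, 0, 0) - fC (a, 0, 0) = 2 := by decide

/-- **Payer of the all-`1` deficit** (P2: the partner cell with all of `S` coloured `1`, type `(≥1,0,0)`, profile `(1,2,0)`): value `2`.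
(finite check) [this work] -/
theorem payer_allOne : ∀ a : Fin 3, a ≠ 0 → kerTAbs (a, 0, 0) (1, 2, 0) = 2 := by decide

/-- **Payer of the `all 0 but one 2` deficit** (P4: the SIBLING cell in the same row with the exceptional neighbour recoloured `1`,
type `(0, ≥1, 0)`, profile `(2,1,0)`): value `2`. (finite check) [this work] -/
theorem payer_sibling : ∀ b : Fin 3, b ≠ 0 → kerTAbs (0, b, 0) (2, 1, 0) = 2 := by decide

/-- **Payer of the `all 0 but one 1` deficit** (P5: the partner cell with all of `S` coloured `2` except the exceptional neighbour coloured
`0`, type `(≥1,0,0)`, profile `(2,0,2)`): value `2`. (finite check) [this work] -/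
theorem payer_allTwoButOne : ∀ a : Fin 3, a ≠ 0 → kerTAbs (a, 0, 0) (2, 0, 2) = 2 := by decide

set_option maxRecDepth 4096 in
/-- **Degree `0` in paired form** (`S = ∅`: the law reads `T(K) ≥ 2·T(K−y)` for a `y` adjacent only to terminals).  For the two base types
`(I₀ ⊕ P, B, I₂)` and `(I₂ ⊕ P', B, I₀)` of a colouring and its `Φ_u`-partner (`I` = internal type, `P, P'` = the `0`- resp. `2`-coloured
neighbours of `u` together with its marks, `B` = the `1`-part) and any increments `k = (k₀, k₁, 0)` with `k₀ ≠ 0`, the two residuals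
`kerTAbs t k − fC t` sum to a nonnegative number. (finite check, `3⁷` cases) [this work] -/
theorem pendant_pair_nonneg : ∀ I₀ I₂ P P' B k₀ k₁ : Fin 3, k₀ ≠ 0 →
    0 ≤ (kerTAbs (capAdd I₀ P, B, I₂) (k₀, k₁, 0) - fC (capAdd I₀ P, B, I₂))
        + (kerTAbs (capAdd I₂ P', B, I₀) (k₀, k₁, 0) - fC (capAdd I₂ P', B, I₀)) := by decide

end Summit.CriticalPhenomena.PercolationContinuityZ3.Theorems.SunflowerPartition.Kempe
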